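import Summits.BirchSwinnertonDyer.BirchSwinnertonDyer.Theorems.ClassRecordThreeKolyvaginClose
import Summits.BirchSwinnertonDyer.Rank1Residual.X11b.KolyvaginBottomPoint
import Summits.BirchSwinnertonDyer.Rank1Residual.X11b.BDPRouteOddPrime
import Summits.BirchSwinnertonDyer.Rank1Residual.X11b.BDPRouteOnTreeStepL
import Literature.NumberTheory.EllipticCurves.HeegnerPointsKolyvaginPrimaryGeneratorProofs
import Literature.NumberTheory.EllipticCurves.BSDSelmerCMPConverseHeegnerFieldProofs
import Literature.NumberTheory.EllipticCurves.NeronIsogenyScalingHoldsProofs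
import Literature.NumberTheory.EllipticCurves.MordellWeilTheoremProofs

/-!
# Route design `KolyvaginRoadThree` — item `KolyGlueAtThree` MODULO ITS TWO SEAMS (K-2 of
# `plan/K2KOLY/DESIGN.md`; cell `bsd-stepL`, seat `bsd-stepL-koly` g6; `--supports stmt-BirchSwinnertonDyer-19106`)

`PublishedInputs… → (Kolyvagin's conjecture mod 3 at EVERY Manin-good conductor-1 frame) → ∀ E ∈ X11b@3 with a (ram)
prime and 3 ∤ ∏c, BSD(E,3)`: the ∀-closed form of the Kolyvagin road on atom A1, with EVERYTHING the tree holds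
discharged — the odd Heegner datum (`X11b.exists_oddHeegnerData`: Hoffstein–Luo field, Manin-good frame by Mazur,
`3 ∤ #𝓞_K^×`, `L(E^{d_K},1) ≠ 0`, twist model), the bottom-point identity `P(1) = y_K` in `E(K̄)`
(`KolyvaginBottom.toGeomPoints_derivedPoint_one_eq`, conditional on the EXISTING named fact
`heegnerPointOfConductor_one_galoisConj`), non-torsion of `y_K` (Gross–Zagier, `r_an = 1`, `L(E^{d_K},1) ≠ 0`),
rank one and `Ш(E/K)` finite (Kolyvagin), `E(K)[3] = 0` (irreducibility over an imaginary quadratic field,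
`torsionBy_eq_bot_of_isImaginaryQuadratic_of_hasIrreducibleModPGaloisRep`), the exponent `3^{M₀} ∥ y_K`
(Mordell–Weil, `exists_pow_smul_eq_and_forall_ne`), then the end-to-end theorem
`Koly.ClassX11b.bsdp_three_of_kolyvaginClass_one_ne_zero_of_mccallum` (`Theorems/ClassRecordThreeKolyvaginClose.lean`).
The TWO SEAMS of DESIGN §3 are carried as HYPOTHESIS SHAPES (no definition introduced): (G-a) `hKD` — a
conductor-1 Kolyvagin–Heegner datum EXISTS on every admissible frame (published CM theory, Gross 1984 §3; to become
a Literature named fact or part of the re-typed conjecture); (G-b) `hZ` — Kolyvagin's conjecture mod 3 at `3 ∥ N`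
stated for EVERY Manin-good frame `(Dt, β, ι)` with `4N ∣ β² − d_K`, `¬ 3 ∣ c(Dt)` (the planner's recommended
re-typing (R2′) of `Koly.ZhangAtThreeSharp`; the ∃-typed tree statement does not instantiate at the consumer's
frame — a frame through `[3]` kills every mod-3 class, so the Manin-good binder is necessary). THEOREMS ONLY;
nothing asserted about either seam; CONDITIONAL on every binder.
-/

noncomputable section

open scoped Classical

namespace Summit.BirchSwinnertonDyer.Rank1Residual.X11b.Three.Koly

open WeierstrassCurve Literature.NumberTheory.EllipticCurves
  Literature.NumberTheory.EllipticCurves.ModularForms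
  Literature.NumberTheory.EllipticCurves.Rank1Residual
  Summit.BirchSwinnertonDyer.Rank1Residual Summit.BirchSwinnertonDyer.Rank1Residual.X11b

/-- **`KolyGlueAtThree` modulo its two seams: the Kolyvagin road decides `BSD(E,3)` on ALL of atom A1.** Under
the published named facts (Gross–Zagier, Kolyvagin ×2, Skinner 2016 Thm C, GZK, modularity, newforms, Hoffstein–Luo,
Mazur's Manin constant, Shimura reciprocity at conductor 1 `hrec`, McCallum's structure theorem `hMc`), the
existence of conductor-1 Kolyvagin–Heegner data on admissible frames (`hKD`, seam G-a) and Kolyvagin's conjecture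
mod 3 at `3 ∥ N` at every Manin-good frame (`hZ`, seam G-b — the ∀-frame form of `Koly.ZhangAtThreeSharp`): for
every `E/ℚ` with `(E,3) ∈ X11b`, a (ram) prime and `3 ∤ ∏_ℓ c_ℓ(E)`, `BSDp W 3`. All K-side data are DISCHARGED
inside (odd Heegner datum, bottom point, non-torsion, rank one, `Ш` finite, no 3-torsion, `3^{M₀} ∥ y_K`).
CONDITIONAL on every binder; nothing booked. [folklore]
[cite: McCallumLMS1991, §5 Cor. 5.6 (p. 310)] [cite: GrossLMS1991, §4 (4.1) and Thm. 1.3]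
[cite: JetchevSkinnerWan2017, §7.4.1–7.4.2 (pp. 30–31)] -/
theorem bsdp_three_onA1_of_kolyvaginFrames
    -- published named facts
    (hGZ : ∀ (N : ℕ) [NeZero N] (W : WeierstrassCurve ℚ) (K : Type) [Field K] [NumberField K],
      gross_zagier N W K)
    (hKo : ∀ (N : ℕ) [NeZero N] (W : WeierstrassCurve ℚ) (K : Type) [Field K] [NumberField K],
      kolyvagin N W K)
    (hB : ∀ (N : ℕ) [NeZero N] (W : WeierstrassCurve ℚ) (K : Type) [Field K] [NumberField K],
      Kolyvagin1990_padicValNat_card_sha_le N W K)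
    (hSk : Skinner2016.thmC_padicValRat_bsd_rank_zero)
    (hGZK : rank_eq_analyticRank_of_analyticRank_le_one) (hmod : hasEntireLFunction_rat)
    (hnf : exists_isNewformOf) (hHL : HoffsteinLuo1997_exists_twist_L_one_ne_zero)
    (hMaz : mazur_not_dvd_maninConstant_of_odd)
    (hrec : ∀ (N : ℕ) [NeZero N] (W : WeierstrassCurve ℚ) (K : Type) [Field K] [NumberField K],
      heegnerPointOfConductor_one_galoisConj N W K)
    (hMc : McCallum1991_pow_dvd_card_sha_primary_of_certificate)
    -- SEAM G-a: conductor-1 Kolyvagin–Heegner data exist on every admissible frame (CM theory; hypothesis shape)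
    (hKD : ∀ (W : WeierstrassCurve ℚ) [W.IsElliptic] [W.IsGloballyMinimal] [NeZero (W.conductorNorm ℤ)]
      (K : Type) [Field K] [NumberField K]
      (Dt : ModularParametrizationData W (W.conductorNorm ℤ)) (β : ℤ) (ι : K →+* ℂ),
      IsImaginaryQuadratic K → SatisfiesHeegnerHypothesis (W.conductorNorm ℤ) K →
      (4 * (W.conductorNorm ℤ : ℤ)) ∣ β ^ 2 - NumberField.discr K →
      Nonempty (KolyvaginHeegnerData Dt β ι 1))
    -- SEAM G-b: Kolyvagin's conjecture mod 3 at 3 ∥ N at EVERY Manin-good frame (hypothesis shape, ∀-form of Z₃♯)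
    (hZ : ∀ (W : WeierstrassCurve ℚ) [W.IsElliptic] [W.IsGloballyMinimal] [NeZero (W.conductorNorm ℤ)]
      (K : Type) [Field K] [NumberField K]
      (Dt : ModularParametrizationData W (W.conductorNorm ℤ)) (β : ℤ) (ι : K →+* ℂ),
      W.HasMultiplicativeReductionAtPrime 3 → W.HasSurjectiveModNGaloisRep 3 →
      (∃ (ℓ : ℕ) (_ : Fact ℓ.Prime), ℓ ≠ 3 ∧ W.HasMultiplicativeReductionAtPrime ℓ ∧
        ¬ 3 ∣ padicValInt ℓ W.minimalDiscriminantInt) →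
      ¬ 3 ∣ W.tamagawaProduct →
      IsImaginaryQuadratic K → SatisfiesHeegnerHypothesis (W.conductorNorm ℤ) K →
      NumberField.discr K ≠ -3 →
      (4 * (W.conductorNorm ℤ : ℤ)) ∣ β ^ 2 - NumberField.discr K → ¬ (3 : ℤ) ∣ Dt.c →
      ∃ (n : ℕ) (d : KolyvaginHeegnerData Dt β ι n),
        KolyvaginDescent.KolSupp (Zhang2014.IsKolyvaginPrime (W.conductorNorm ℤ) W K 3) n ∧
          d.kolyvaginClass Nat.prime_three 1 ≠ 0)
    -- the pair
    (W : WeierstrassCurve ℚ) [W.IsElliptic] [W.IsGloballyMinimal]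
    (hX : ClassX11b W 3) (hram : Ram W 3) (htam : ¬ 3 ∣ W.tamagawaProduct) : BSDp W 3 := by
  haveI : NeZero (W.conductorNorm ℤ) := ⟨(W.conductorNorm_pos_holds).ne'⟩
  have hmult : W.HasMultiplicativeReductionAtPrime 3 := hX.2.2.1
  have hirr : Irr W 3 := hX.2.2.2
  have hρ : Surj W 3 := surj_of_irr_of_ram W 3 hirr hram
  -- ONE odd Heegner datum with a Manin-good frame (Hoffstein–Luo field; Mazur; w_K = 2)
  obtain ⟨K, _, _, Dt, H, ι, P, Wd, _, _, Cd, hK, hodd, h3d, hHN, hP, hc, hμ, hLt, hWd⟩ :=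
    exists_oddHeegnerData hnf hHL hMaz integral_neronScaling_of_isGloballyMinimal_holds W 3 hX.1
      (by decide) hmult hirr
  have h3 : NumberField.discr K ≠ -3 := by
    intro h
    exact h3d (h ▸ ⟨-1, by norm_num⟩)
  -- seam G-a: a conductor-1 Kolyvagin–Heegner datum on the frame (Dt, H.β, ι)
  obtain ⟨d₁⟩ := hKD W K Dt H.β ι hK hHN H.dvd_sq_sub
  -- the bottom point: P(1) = y_K = P in E(K̄) (Shimura reciprocity at conductor 1, named fact `hrec`)
  have hPd : d₁.toGeomPoints d₁.derivedPoint = toGeomPoints (W.baseChange K) P :=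
    KolyvaginBottom.toGeomPoints_derivedPoint_one_eq (hrec _ W K) hK hHN hP d₁ rfl
  -- y_K is non-torsion (Gross–Zagier at r_an = 1 with L(E^{d_K},1) ≠ 0); rank one, Ш finite (Kolyvagin)
  have hPinf : ¬ IsOfFinAddOrder P :=
    not_isOfFinAddOrder_of_heegner_of_analyticRank_eq_one W (W.conductorNorm ℤ) K Dt H ι P (hGZ _ W K) hmod
      hX.1 hK hHN hLt hP
  obtain ⟨hrank, hSha⟩ := hKo (W.conductorNorm ℤ) W K hK hHN ⟨Dt, H, ι, hP⟩ hPinf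
  haveI : Finite (W.baseChange K).sha := hSha
  -- E(K)[3] = 0 (E[3] irreducible, K imaginary quadratic)
  have hbot := torsionBy_eq_bot_of_isImaginaryQuadratic_of_hasIrreducibleModPGaloisRep W K hK
    Nat.prime_three hirr
  have hiv : ∀ x : (W.baseChange K).toAffine.Point, 3 • x = 0 → x = 0 := fun x hx ↦ by
    have hmem : x ∈ AddSubgroup.torsionBy (W.baseChange K).toAffine.Point ((3 : ℕ) : ℤ) := by
      rw [mem_torsionBy_iff, natCast_zsmul]
      exact hx
    rw [hbot] at hmem
    exact hmem
  -- the exponent 3^{M₀} ∥ y_K (Mordell–Weil)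
  haveI : Module.Finite ℤ (W.baseChange K).toAffine.Point := (W.baseChange K).module_finite_point_holds
  obtain ⟨M₀, x₀, hx₀, hmax⟩ := exists_pow_smul_eq_and_forall_ne hPinf (p := 3) (by norm_num)
  have hdiv : ∃ Q : (W.baseChange K).toAffine.Point, ((3 ^ M₀ : ℕ) : ℤ) • Q = P :=
    ⟨x₀, by rw [natCast_zsmul]; exact hx₀⟩
  have hndiv : ¬ ∃ Q : (W.baseChange K).toAffine.Point, ((3 ^ (M₀ + 1) : ℕ) : ℤ) • Q = P := by
    rintro ⟨Q, hQ⟩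
    exact hmax Q (by rw [← natCast_zsmul]; exact hQ)
  -- seam G-b: Kolyvagin's conjecture mod 3 at this Manin-good frame
  obtain ⟨n, d, hn, hne⟩ := hZ W K Dt H.β ι hmult hρ hram htam hK hHN h3 H.dvd_sq_sub hc
  -- the end-to-end theorem at this datum
  exact ClassX11b.bsdp_three_of_kolyvaginClass_one_ne_zero_of_mccallum W K Dt H ι P (hGZ _ W K) (hKo _ W K)
    (hB _ W K) hSk hGZK hmod hX hram htam hK hodd hHN hP hc hLt Wd Cd hWd H.β d₁ hPd hPinf hrank hiv hdiv hndiv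
    d hn hne hMc

end Summit.BirchSwinnertonDyer.Rank1Residual.X11b.Three.Koly

end
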